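import Literature.MathematicalPhysics.QuantumFieldTheory.Balaban1983to89.Node00.OpsYSectDQ
import Literature.MathematicalPhysics.QuantumFieldTheory.Balaban1983to89.Node00.OpsYCoarseBondRep

/-!
# `Balaban1983to89.Node00.OpsYDeltaAFlat` — [Balaban1985BackgroundPropagators] (3.25)–(3.27) OVER A GENERIC SITE PAIR `(𝔭, 𝔭⋆)`, AND THE FLAT
# SITE LETTER OF RECORD `Q′♭` (RESTRICTION TO THE `k`-CENTRES): `R♭ = I − G′♭Q′♭⋆(Q′♭G′♭²Q′♭⋆)⁻¹Q′♭G′♭`, `Δ_a♭[𝔮] = Δ + D R♭ D* + 𝔮⋆a𝔮`, `G♭[𝔮] = (Δ_a♭[𝔮])⁻¹`,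
# `H♭[𝔮] = G♭𝔮⋆(𝔮G♭𝔮⋆)⁻¹` — Node 00 instance layer (def-Y)

statement-level skeleton of published theorems with citation tags; proofs where landed; nothing here is a claim about the
Yang–Mills mass gap

`[Balaban1985BackgroundPropagators]` (CMP **99** (1985) 389–434) p. 394: *«R = R(U) is an orthogonal projection in the Hilbert space L²(Ω₀, 𝔤) onto the subspace
ℛ = Δ^η_U N(Q′), N(Q′) = {λ : Q′λ = 0}»* (3.21), *«operators Q′_j(U) are linear parts of the averaging operations R_u^j for gauge transformations»* (3.19),
*«Δ′_a = (Δ^η_U + Q′\*aQ′)|Ω₀ … Its inverse is denoted by G′»* (3.24), *«Rf = (I − G′Q′\*(Q′G′²Q′\*)⁻¹Q′G′)f»* (3.25); p. 395 (3.26) *«Δ_a = Δ + DRD\* + Q\*aQ»*,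
(3.27) *«G(U) = Δ_a(U)⁻¹»*; p. 420 (3.126) *«HB = G̃Q\*(QG̃Q\*)⁻¹B»*.  `[Balaban1985Averaging]` (CMP **98**) (11) p. 19 (the coarse gauge map of the covariant average acts
through the block CENTRES).  Pages held: `paper:balaban1985-cmp99-background-propagators` pp. 392–396, 418–422.

WHY THIS FILE (custodian word (ρ♭), cell bus 2026-08-31, to dag-n06-l's «P-H♭» (q1); shape (S1)–(S3) of the second reader node00-def-RR-2).  The (ℓa-H)
gauge letter of the BACKGROUND SCHEME OF RECORD, `BgGaugeLetterOfRecord.H1OfRecordAtBgFlat = H1OfRecord … (QOfRecord U₀) (QflatOfRecord)`, carries the restriction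
`RrOfRecord … Q′♭ = RLatticeK … Q′♭ = projR (Δ^η_{U₀}) Q′♭` — the orthogonal projection onto `Δ^η_{U₀} N(Q′♭)` for the FLAT site letter `Q′♭ = QflatOfRecord F N k :
(sites) → (Site (F.P K) k → M_N(ℂ))`, `(Q′♭λ)(y) = λ(embIter k y)` (restriction to the centres of the `k`-blocks of the WHOLE torus; [B12] (11): the linearisation
of the coarse gauge map `u ↦ u ∘ embIter k` under which the record's covariant averaging transforms).  Every `(3.25)`-letter of the `OpsY` layer so far
(`OpsYDeltaA.RY ∕ XY ∕ XinvY ∕ deltaAY ∕ GAY`, `OpsYSectDQ.deltaAQY ∕ GAQY`) is keyed to the BLOCK-AVERAGE site letter `QpY parS` (kernel `QM i.D` transported along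
`parS`, indexed by the multi-level blocks `𝔅`); the two restrictions project onto different subspaces, so the slot-(a) `OpsY` row that is to be read back onto
`H1OfRecordAtBgFlat` must be typed at the flat pair — and that pair must be indexed by the `k`-LATTICE `Site (PV …) i.k` (the target of `QflatOfRecord`), not by
`𝔅` (on a territory of level `j < k` there are more `𝔅`-blocks than `k`-centres, so no `𝔅`-indexed restriction has the kernel of `Q′♭`; and the block corner
`blkCornerY` is the LOWER corner `L^j·label`, never a transported centre).  THIS FILE supplies the letters: §1 rebuilds (3.25) over an ARBITRARY site pair
`𝔭 : CfgY → (site fns →ₗ X-fns)`, `𝔭⋆` (reverse), ANY target carrier `X`, and site propagator `G′` — `XQY = 𝔭G′G′𝔭⋆`, `XinvQY = (𝔭G′²𝔭⋆)⁻¹` (`Ring.inverse`),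
`PQY = G′𝔭⋆(𝔭G′²𝔭⋆)⁻¹𝔭G′`, `RQY = I − PQY` — with the `rfl` faces recovering `XY ∕ XinvY ∕ RY` at `(QpY parS, QpsY parS)`, the projection algebra on the unit
locus of `X` (`R² = R`, `𝔭G′R = 0`, `RG′𝔭⋆ = 0`, `P² = P`), the junk row off it (`R = I`), degree `0` in `G′`, and trace-symmetry at `M_N(ℂ)`; §2 the slot-(a) form
and inverse over BOTH pairs, `deltaAQQY 𝔮 𝔮⋆ 𝔭 𝔭⋆ G′ = Δ + D∘RQY∘D* + 𝔮⋆a𝔮`, `GAQQY = Ring.inverse ∘ deltaAQQY` (faces `deltaAQY = deltaAQQY … (QpY parS) (QpsY parS)`,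
`GAQY = …`, `deltaAY = …`, `GAY = …`, all `rfl`); §3 the FLAT pair of record in the `OpsY` carriers — `KSiteY i = Site (PV d ℓ i.m i.K hd hL) i.k`, the chart image
`kCtrY i y = boxEquiv i.hN (embIter i.k y)` of a `k`-centre (injective in the standing range `i.hk`), `QkY i` (`(Q′♭λ)(y) = λ(kCtrY i y)`: `QflatOfRecord_apply` read
through the chart — configuration-FREE, `Ω`-free, NO datum), `QksY i` (extension by zero, the weight-`1` trace adjoint), `Q′♭Q′♭⋆ = 1`, print's
`Δ′♭_a(U) = Δ_U + Q′♭⋆a′Q′♭` and `G′♭ = (Δ′♭_a)⁻¹`, and the abbreviations `XFlatY ∕ RFlatY ∕ deltaAFlatY ∕ GAFlatY ∕ QGAQinvFlatY ∕ HAFlatY` (the last two are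
`OpsYSectDQ.QGQinvOfQY ∕ HOfQY` at `G := GAFlatY`); §3b trace-adjointness ∕ symmetry of the flat letters at `M_N(ℂ)`.  WEIGHTS: `QksY` is the adjoint of `QkY` for the
UNWEIGHTED site ∕ `k`-site trace pairings; the background scheme's `projR` is orthogonal for `SiteL2K`'s UNIFORMLY weighted pairing (`c0Rec F K k`, `WRec N`) — a uniform
positive weight does not change orthogonal complements, and the one scalar between the two adjoints of `Q′♭` is absorbed by the datum `a′`.

SCOPE: DEFINITIONS + `rfl` faces + ring algebra + trace-symmetry bookkeeping.  NO estimate (Thms 3.2 ∕ 3.3 ∕ 3.11 ∕ 3.12 at the centres pair are dag-n06-*'s rows); NO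
readback identity `H♭ = readback (HAFlatY …)` (owed separately, with the carrier transport of record); O5 ∕ N06 ∕ N07 are NOT discharged here; count-neutral.
-/

namespace Literature.MathematicalPhysics.QuantumFieldTheory.Balaban1983to89.Node00.OpsYDeltaAFlat

open Literature.MathematicalPhysics.QuantumFieldTheory.Balaban1983to89.Node00
open B6KLevelCensusIndexV1 (KIdx)
open B6GlobalChartV1 (boxEquiv PV)
open B15DeterminingSets (embIter)
open B9Thm311ReadingCoords (IsSymmTr IsAdjTr)
open B9Thm311AdjointPairs (isAdjTr_trLiftY_transpose isSymmTr_sandwich_of_isAdjTr isAdjTr_reverse isSymmTr_comp_self isSymmTr_sub isSymmTr_id)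
open B9Thm311DeltaPrimeSymm (isSymmTr_add lapSL_isSymmTr)
open B9Ineq349SiteAdjoint (isSymmTr_ringInverse)
open scoped Matrix

noncomputable section

variable {d ℓ : ℕ} {hd : 1 ≤ d + 1} {hL : Odd (ℓ + 1) ∧ 1 < ℓ + 1} {b₀ b₁ : ℝ}
variable {𝔸 : Type} [NormedRing 𝔸] [NormedAlgebra ℂ 𝔸] [CompleteSpace 𝔸]

/-! ## §1 (3.25) over a generic site pair `(𝔭, 𝔭⋆)` with ANY target carrier `X`, and site propagator `G′` -/

section GenericSitePair

variable (i : KIdx d ℓ hd hL b₀ b₁) {X : Type}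
variable (𝔭 : CfgY 𝔸 i → ((SiteY i → 𝔸) →ₗ[ℂ] (X → 𝔸))) (𝔭s : CfgY 𝔸 i → ((X → 𝔸) →ₗ[ℂ] (SiteY i → 𝔸))) (Gp : SiteOpY 𝔸 i)

/-- `X[𝔭, G′](U) := 𝔭(U) G′(U) G′(U) 𝔭⋆(U)` — (3.25)'s `Q′G′²Q′*` over a generic site pair. [cite: Balaban1985BackgroundPropagators, (3.25) p.394] -/
def XQY (U : CfgY 𝔸 i) : (X → 𝔸) →ₗ[ℂ] (X → 𝔸) := 𝔭 U ∘ₗ Gp U ∘ₗ Gp U ∘ₗ 𝔭s U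

/-- `(𝔭G′²𝔭⋆)⁻¹(U)` (`Ring.inverse`: the inverse on the unit locus, `0` off it). [cite: Balaban1985BackgroundPropagators, (3.25) p.394, Thm 3.2 p.398] -/
def XinvQY (U : CfgY 𝔸 i) : (X → 𝔸) →ₗ[ℂ] (X → 𝔸) := Ring.inverse (XQY i 𝔭 𝔭s Gp U)

/-- `P[𝔭, G′](U) := G′𝔭⋆(𝔭G′²𝔭⋆)⁻¹𝔭G′` — the complementary projection `I − R` of (3.25). [cite: Balaban1985BackgroundPropagators, (3.25) p.394] -/
def PQY (U : CfgY 𝔸 i) : (SiteY i → 𝔸) →ₗ[ℂ] (SiteY i → 𝔸) := Gp U ∘ₗ 𝔭s U ∘ₗ XinvQY i 𝔭 𝔭s Gp U ∘ₗ 𝔭 U ∘ₗ Gp U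

/-- ★ **`R[𝔭, G′](U) := I − G′𝔭⋆(𝔭G′²𝔭⋆)⁻¹𝔭G′` — (3.25) OVER A GENERIC SITE PAIR** (print: the orthogonal projection onto `Δ^η_U N(Q′)` (3.21), written with
`G′ = (Δ′_a)⁻¹`). [cite: Balaban1985BackgroundPropagators, (3.21) p.394, (3.25) p.394] -/
def RQY (U : CfgY 𝔸 i) : (SiteY i → 𝔸) →ₗ[ℂ] (SiteY i → 𝔸) := LinearMap.id - PQY i 𝔭 𝔭s Gp U

/-- `R = I − P`, unfolded. [cite: Balaban1985BackgroundPropagators, (3.25) p.394, bookkeeping] -/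
theorem RQY_eq (U : CfgY 𝔸 i) : RQY i 𝔭 𝔭s Gp U = LinearMap.id - Gp U ∘ₗ 𝔭s U ∘ₗ XinvQY i 𝔭 𝔭s Gp U ∘ₗ 𝔭 U ∘ₗ Gp U := rfl

/-- def-Y's `XY` IS `XQY` at the block-average pair `(QpY parS, QpsY parS)` (`rfl`). [cite: Balaban1985BackgroundPropagators, (3.25) p.394, bookkeeping] -/
theorem XY_eq_XQY (parS : SiteParY 𝔸 i) (U : CfgY 𝔸 i) : XY i parS Gp U = XQY i (QpY i parS) (QpsY i parS) Gp U := rfl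

/-- def-Y's `XinvY` IS `XinvQY` at the block-average pair (`rfl`). [cite: Balaban1985BackgroundPropagators, (3.25) p.394, bookkeeping] -/
theorem XinvY_eq_XinvQY (parS : SiteParY 𝔸 i) (U : CfgY 𝔸 i) : XinvY i parS Gp U = XinvQY i (QpY i parS) (QpsY i parS) Gp U := rfl

/-- ★ def-Y's (3.25) letter `RY` IS `RQY` at the block-average pair (`rfl`): every `RQY` law below specialises to `RY`. [cite: Balaban1985BackgroundPropagators, (3.25) p.394, bookkeeping] -/
theorem RY_eq_RQY (parS : SiteParY 𝔸 i) (U : CfgY 𝔸 i) : RY i parS Gp U = RQY i (QpY i parS) (QpsY i parS) Gp U := rfl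

/-- … as letters. [cite: Balaban1985BackgroundPropagators, (3.25) p.394, bookkeeping] -/
theorem RY_eq_RQY' (parS : SiteParY 𝔸 i) : RY i parS Gp = RQY i (QpY i parS) (QpsY i parS) Gp := rfl

variable {𝔭 𝔭s Gp}

/-- on the unit locus: `X · X⁻¹ = 1`. [cite: Balaban1985BackgroundPropagators, (3.25) p.394, Thm 3.2 p.398] -/
theorem XQY_mul_XinvQY {U : CfgY 𝔸 i} (hX : IsUnit (XQY i 𝔭 𝔭s Gp U)) : XQY i 𝔭 𝔭s Gp U * XinvQY i 𝔭 𝔭s Gp U = 1 :=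
  Ring.mul_inverse_cancel _ hX

/-- on the unit locus: `X⁻¹ · X = 1`. [cite: Balaban1985BackgroundPropagators, (3.25) p.394, Thm 3.2 p.398] -/
theorem XinvQY_mul_XQY {U : CfgY 𝔸 i} (hX : IsUnit (XQY i 𝔭 𝔭s Gp U)) : XinvQY i 𝔭 𝔭s Gp U * XQY i 𝔭 𝔭s Gp U = 1 :=
  Ring.inverse_mul_cancel _ hX

/-- off the unit locus the inverse letter is `0`. [cite: Balaban1985BackgroundPropagators, (3.25) p.394, bookkeeping] -/
theorem XinvQY_of_not_isUnit {U : CfgY 𝔸 i} (hX : ¬ IsUnit (XQY i 𝔭 𝔭s Gp U)) : XinvQY i 𝔭 𝔭s Gp U = 0 :=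
  Ring.inverse_non_unit _ hX

/-- … so `P = 0` there … [cite: Balaban1985BackgroundPropagators, (3.25) p.394, bookkeeping] -/
theorem PQY_of_not_isUnit {U : CfgY 𝔸 i} (hX : ¬ IsUnit (XQY i 𝔭 𝔭s Gp U)) : PQY i 𝔭 𝔭s Gp U = 0 := by
  simp only [PQY, XinvQY_of_not_isUnit i hX, LinearMap.zero_comp, LinearMap.comp_zero]

/-- … and `R = I` (the junk row: no constraint is imposed off the unit locus). [cite: Balaban1985BackgroundPropagators, (3.25) p.394, bookkeeping] -/
theorem RQY_of_not_isUnit {U : CfgY 𝔸 i} (hX : ¬ IsUnit (XQY i 𝔭 𝔭s Gp U)) : RQY i 𝔭 𝔭s Gp U = LinearMap.id := by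
  rw [RQY, PQY_of_not_isUnit i hX, sub_zero]

/-- `𝔭G′ ∘ P = 𝔭G′` on the unit locus (from `X X⁻¹ = 1`). [cite: Balaban1985BackgroundPropagators, (3.20)–(3.21) p.394, (3.25) p.394] -/
theorem p_Gp_comp_PQY {U : CfgY 𝔸 i} (hX : IsUnit (XQY i 𝔭 𝔭s Gp U)) :
    𝔭 U ∘ₗ Gp U ∘ₗ PQY i 𝔭 𝔭s Gp U = 𝔭 U ∘ₗ Gp U := by
  have h := XQY_mul_XinvQY i hX
  calc 𝔭 U ∘ₗ Gp U ∘ₗ PQY i 𝔭 𝔭s Gp U = (XQY i 𝔭 𝔭s Gp U * XinvQY i 𝔭 𝔭s Gp U) ∘ₗ (𝔭 U ∘ₗ Gp U) := by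
        simp only [PQY, XQY, Module.End.mul_eq_comp, LinearMap.comp_assoc]
    _ = 𝔭 U ∘ₗ Gp U := by rw [h, Module.End.one_eq_id, LinearMap.id_comp]

/-- ★★ **THE GAUGE CONDITION `𝔭(U) G′(U) R(U) = 0`** on the unit locus of `X` — print's «Q′G′λ = 0 on the range of R» ((3.20)–(3.21)) over a generic site pair.
[cite: Balaban1985BackgroundPropagators, (3.20)–(3.21) p.394, (3.25) p.394] -/
theorem p_Gp_comp_RQY {U : CfgY 𝔸 i} (hX : IsUnit (XQY i 𝔭 𝔭s Gp U)) : 𝔭 U ∘ₗ Gp U ∘ₗ RQY i 𝔭 𝔭s Gp U = 0 := by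
  rw [RQY, LinearMap.comp_sub, LinearMap.comp_sub, LinearMap.comp_id, p_Gp_comp_PQY i hX, sub_self]

/-- `P ∘ G′𝔭⋆ = G′𝔭⋆` on the unit locus (from `X⁻¹ X = 1`). [cite: Balaban1985BackgroundPropagators, (3.25) p.394, bookkeeping] -/
theorem PQY_comp_Gp_ps {U : CfgY 𝔸 i} (hX : IsUnit (XQY i 𝔭 𝔭s Gp U)) :
    PQY i 𝔭 𝔭s Gp U ∘ₗ (Gp U ∘ₗ 𝔭s U) = Gp U ∘ₗ 𝔭s U := by
  have h := XinvQY_mul_XQY i hX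
  calc PQY i 𝔭 𝔭s Gp U ∘ₗ (Gp U ∘ₗ 𝔭s U) = (Gp U ∘ₗ 𝔭s U) ∘ₗ (XinvQY i 𝔭 𝔭s Gp U * XQY i 𝔭 𝔭s Gp U) := by
        simp only [PQY, XQY, Module.End.mul_eq_comp, LinearMap.comp_assoc]
    _ = Gp U ∘ₗ 𝔭s U := by rw [h, Module.End.one_eq_id, LinearMap.comp_id]

/-- the transposed gauge condition `R(U) G′(U) 𝔭⋆(U) = 0` on the unit locus. [cite: Balaban1985BackgroundPropagators, (3.20)–(3.21) p.394, (3.25) p.394] -/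
theorem RQY_comp_Gp_ps {U : CfgY 𝔸 i} (hX : IsUnit (XQY i 𝔭 𝔭s Gp U)) : RQY i 𝔭 𝔭s Gp U ∘ₗ (Gp U ∘ₗ 𝔭s U) = 0 := by
  rw [RQY, LinearMap.sub_comp, LinearMap.id_comp, PQY_comp_Gp_ps i hX, sub_self]

/-- `P ∘ P = P` on the unit locus. [cite: Balaban1985BackgroundPropagators, (3.25) p.394, bookkeeping] -/
theorem PQY_comp_PQY {U : CfgY 𝔸 i} (hX : IsUnit (XQY i 𝔭 𝔭s Gp U)) :
    PQY i 𝔭 𝔭s Gp U ∘ₗ PQY i 𝔭 𝔭s Gp U = PQY i 𝔭 𝔭s Gp U := by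
  have h := p_Gp_comp_PQY i hX
  calc PQY i 𝔭 𝔭s Gp U ∘ₗ PQY i 𝔭 𝔭s Gp U
        = Gp U ∘ₗ 𝔭s U ∘ₗ XinvQY i 𝔭 𝔭s Gp U ∘ₗ (𝔭 U ∘ₗ Gp U ∘ₗ PQY i 𝔭 𝔭s Gp U) := by simp only [PQY, LinearMap.comp_assoc]
    _ = PQY i 𝔭 𝔭s Gp U := by rw [h, PQY]

/-- ★ **`R(U) ∘ R(U) = R(U)`** on the unit locus of `X` — (3.25) is a projection, over a generic site pair. [cite: Balaban1985BackgroundPropagators, (3.21) p.394, (3.25) p.394] -/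
theorem RQY_comp_RQY {U : CfgY 𝔸 i} (hX : IsUnit (XQY i 𝔭 𝔭s Gp U)) :
    RQY i 𝔭 𝔭s Gp U ∘ₗ RQY i 𝔭 𝔭s Gp U = RQY i 𝔭 𝔭s Gp U := by
  rw [RQY, LinearMap.sub_comp, LinearMap.id_comp, LinearMap.comp_sub, LinearMap.comp_id, PQY_comp_PQY i hX, sub_self, sub_zero]

/-- `R ∘ P = 0` on the unit locus. [cite: Balaban1985BackgroundPropagators, (3.25) p.394, bookkeeping] -/
theorem RQY_comp_PQY {U : CfgY 𝔸 i} (hX : IsUnit (XQY i 𝔭 𝔭s Gp U)) : RQY i 𝔭 𝔭s Gp U ∘ₗ PQY i 𝔭 𝔭s Gp U = 0 := by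
  rw [RQY, LinearMap.sub_comp, LinearMap.id_comp, PQY_comp_PQY i hX, sub_self]

/-- `Rλ = λ` whenever `Pλ = 0` (any configuration). [cite: Balaban1985BackgroundPropagators, (3.21) p.394 («Rλ = λ» on N), bookkeeping] -/
theorem RQY_apply_of_PQY_eq_zero (U : CfgY 𝔸 i) {lam : SiteY i → 𝔸} (h : PQY i 𝔭 𝔭s Gp U lam = 0) : RQY i 𝔭 𝔭s Gp U lam = lam := by
  rw [RQY, LinearMap.sub_apply, LinearMap.id_apply, h, sub_zero]

/-- `X[𝔭, c·G′] = c²·X[𝔭, G′]`. [cite: Balaban1985BackgroundPropagators, (3.25) p.394, bookkeeping] -/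
theorem XQY_smul_Gp (c : ℂ) (U : CfgY 𝔸 i) : XQY i 𝔭 𝔭s (c • Gp) U = c ^ 2 • XQY i 𝔭 𝔭s Gp U := by
  simp only [XQY, Pi.smul_apply, LinearMap.smul_comp, LinearMap.comp_smul, smul_smul, pow_two]

/-- `(𝔭(cG′)²𝔭⋆)⁻¹ = c⁻²·(𝔭G′²𝔭⋆)⁻¹` for `c ≠ 0`. [cite: Balaban1985BackgroundPropagators, (3.25) p.394, bookkeeping] -/
theorem XinvQY_smul_Gp {c : ℂ} (hc : c ≠ 0) (U : CfgY 𝔸 i) : XinvQY i 𝔭 𝔭s (c • Gp) U = (c ^ 2)⁻¹ • XinvQY i 𝔭 𝔭s Gp U := by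
  rw [XinvQY, XinvQY, XQY_smul_Gp, ringInverse_smul_linearMap (pow_ne_zero 2 hc)]

/-- ★ **`R[𝔭, c·G′] = R[𝔭, G′]` for `c ≠ 0`** — (3.25) is homogeneous of degree `0` in the site propagator, over a generic site pair (lattice vs physical units of `G′`).
[cite: Balaban1985BackgroundPropagators, (3.25) p.394] -/
theorem RQY_smul_Gp {c : ℂ} (hc : c ≠ 0) (U : CfgY 𝔸 i) : RQY i 𝔭 𝔭s (c • Gp) U = RQY i 𝔭 𝔭s Gp U := by
  have hk : c * (c ^ 2)⁻¹ * c = 1 := by field_simp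
  rw [RQY_eq, RQY_eq, Pi.smul_apply, XinvQY_smul_Gp i hc]
  simp only [LinearMap.smul_comp, LinearMap.comp_smul, smul_smul, hk, one_smul]

end GenericSitePair

/-! ### §1b Trace-symmetry of the generic (3.25) letters at `𝔸 = M_N(ℂ)` -/

section Symm

open scoped Matrix.Norms.L2Operator

variable {N : ℕ} (i : KIdx d ℓ hd hL b₀ b₁) {X : Type} [Fintype X]
variable {𝔭 : CfgY (Matrix (Fin N) (Fin N) ℂ) i → ((SiteY i → Matrix (Fin N) (Fin N) ℂ) →ₗ[ℂ] (X → Matrix (Fin N) (Fin N) ℂ))}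
  {𝔭s : CfgY (Matrix (Fin N) (Fin N) ℂ) i → ((X → Matrix (Fin N) (Fin N) ℂ) →ₗ[ℂ] (SiteY i → Matrix (Fin N) (Fin N) ℂ))}
  {Gp : SiteOpY (Matrix (Fin N) (Fin N) ℂ) i} (w : X → ℝ)

/-- `𝔭G′²𝔭⋆(U)` is `w`-symmetric when `G′(U)` is symmetric and `𝔭⋆(U)` is the `(1, w)`-adjoint of `𝔭(U)`. [cite: Balaban1985BackgroundPropagators, (3.25) p.394; Balaban1984PropagatorsII, (2.69) p.235] -/
theorem XQY_isSymmTr (U : CfgY (Matrix (Fin N) (Fin N) ℂ) i) (hGp : IsSymmTr (fun _ => (1 : ℝ)) (Gp U)) (hadj : IsAdjTr (fun _ => (1 : ℝ)) w (𝔭 U) (𝔭s U)) :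
    IsSymmTr w (XQY i 𝔭 𝔭s Gp U) := by
  have h := isSymmTr_sandwich_of_isAdjTr (isAdjTr_reverse hadj) (isSymmTr_comp_self hGp)
  rw [XQY]
  simpa only [LinearMap.comp_assoc] using h

/-- `(𝔭G′²𝔭⋆)⁻¹(U)` is `w`-symmetric under the same hypotheses. [cite: Balaban1985BackgroundPropagators, (3.25) p.394, bookkeeping] -/
theorem XinvQY_isSymmTr (U : CfgY (Matrix (Fin N) (Fin N) ℂ) i) (hGp : IsSymmTr (fun _ => (1 : ℝ)) (Gp U)) (hadj : IsAdjTr (fun _ => (1 : ℝ)) w (𝔭 U) (𝔭s U)) :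
    IsSymmTr w (XinvQY i 𝔭 𝔭s Gp U) :=
  isSymmTr_ringInverse _ (XQY_isSymmTr i w U hGp hadj)

/-- `P(U)` is symmetric under the same hypotheses. [cite: Balaban1985BackgroundPropagators, (3.25) p.394, bookkeeping] -/
theorem PQY_isSymmTr (U : CfgY (Matrix (Fin N) (Fin N) ℂ) i) (hGp : IsSymmTr (fun _ => (1 : ℝ)) (Gp U)) (hadj : IsAdjTr (fun _ => (1 : ℝ)) w (𝔭 U) (𝔭s U)) :
    IsSymmTr (fun _ => (1 : ℝ)) (PQY i 𝔭 𝔭s Gp U) := by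
  have hS : IsSymmTr (fun _ => (1 : ℝ)) (𝔭s U ∘ₗ XinvQY i 𝔭 𝔭s Gp U ∘ₗ 𝔭 U) := isSymmTr_sandwich_of_isAdjTr hadj (XinvQY_isSymmTr i w U hGp hadj)
  have hT : IsSymmTr (fun _ => (1 : ℝ)) (Gp U ∘ₗ (𝔭s U ∘ₗ XinvQY i 𝔭 𝔭s Gp U ∘ₗ 𝔭 U) ∘ₗ Gp U) := isSymmTr_sandwich_of_isAdjTr (Q := Gp U) (Qs := Gp U) hGp hS
  rw [PQY]
  simpa only [LinearMap.comp_assoc] using hT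

/-- ★ **`R(U)` (3.25) over a generic site pair is trace-symmetric** (print: «an orthogonal projection») when `G′(U)` is symmetric and `𝔭⋆(U)` is the adjoint of `𝔭(U)`.
[cite: Balaban1985BackgroundPropagators, (3.20)–(3.21) p.394, (3.25) p.394] -/
theorem RQY_isSymmTr (U : CfgY (Matrix (Fin N) (Fin N) ℂ) i) (hGp : IsSymmTr (fun _ => (1 : ℝ)) (Gp U)) (hadj : IsAdjTr (fun _ => (1 : ℝ)) w (𝔭 U) (𝔭s U)) :
    IsSymmTr (fun _ => (1 : ℝ)) (RQY i 𝔭 𝔭s Gp U) := by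
  rw [RQY]
  exact isSymmTr_sub (isSymmTr_id _) (PQY_isSymmTr i w U hGp hadj)

end Symm

/-! ## §2 The slot-(a) form `Δ_a[𝔮; 𝔭, G′]` and inverse `G[𝔮; 𝔭, G′]` over both pairs -/

section SlotA

variable (i : KIdx d ℓ hd hL b₀ b₁)
variable (𝔮 : CfgY 𝔸 i → ((FBondY i → 𝔸) →ₗ[ℂ] (IBondY i → 𝔸))) (𝔮s : CfgY 𝔸 i → ((IBondY i → 𝔸) →ₗ[ℂ] (FBondY i → 𝔸))) {X : Type}
variable (𝔭 : CfgY 𝔸 i → ((SiteY i → 𝔸) →ₗ[ℂ] (X → 𝔸))) (𝔭s : CfgY 𝔸 i → ((X → 𝔸) →ₗ[ℂ] (SiteY i → 𝔸))) (Gp : SiteOpY 𝔸 i)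

/-- ★ **`Δ_a[𝔮; 𝔭, G′](U) := Δ(U) + D_U R[𝔭, G′](U) D*_U + 𝔮⋆(U) a 𝔮(U)` — (3.26) over a generic bond pair AND a generic site pair.**
[cite: Balaban1985BackgroundPropagators, (3.26) p.395] -/
def deltaAQQY (U : CfgY 𝔸 i) : (FBondY i → 𝔸) →ₗ[ℂ] (FBondY i → 𝔸) :=
  hessY i U + gradY i U ∘ₗ RQY i 𝔭 𝔭s Gp U ∘ₗ divY i U + 𝔮s U ∘ₗ aY i ∘ₗ 𝔮 U

/-- ★ **`G[𝔮; 𝔭, G′](U) := Δ_a[𝔮; 𝔭, G′](U)⁻¹` — (3.27)** (`Ring.inverse`, total). [cite: Balaban1985BackgroundPropagators, (3.27) p.395] -/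
def GAQQY : BondOpY 𝔸 i := fun U => Ring.inverse (deltaAQQY i 𝔮 𝔮s 𝔭 𝔭s Gp U)

/-- `G[𝔮; 𝔭, G′]`, evaluated. [cite: Balaban1985BackgroundPropagators, (3.27) p.395, bookkeeping] -/
theorem GAQQY_apply (U : CfgY 𝔸 i) : GAQQY i 𝔮 𝔮s 𝔭 𝔭s Gp U = Ring.inverse (deltaAQQY i 𝔮 𝔮s 𝔭 𝔭s Gp U) := rfl

/-- `OpsYSectDQ.deltaAQY` IS `deltaAQQY` at the block-average site pair (`rfl`). [cite: Balaban1985BackgroundPropagators, (3.26) p.395, bookkeeping] -/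
theorem deltaAQY_eq_deltaAQQY (parS : SiteParY 𝔸 i) (U : CfgY 𝔸 i) :
    deltaAQY i 𝔮 𝔮s parS Gp U = deltaAQQY i 𝔮 𝔮s (QpY i parS) (QpsY i parS) Gp U := rfl

/-- `OpsYSectDQ.GAQY` IS `GAQQY` at the block-average site pair (`rfl`). [cite: Balaban1985BackgroundPropagators, (3.27) p.395, bookkeeping] -/
theorem GAQY_eq_GAQQY (parS : SiteParY 𝔸 i) : GAQY i 𝔮 𝔮s parS Gp = GAQQY i 𝔮 𝔮s (QpY i parS) (QpsY i parS) Gp := rfl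

/-- def-Y's straight-contour letter `OpsYDeltaA.deltaAY` IS `deltaAQQY` at `(QY parB, QsY parB)` × the block-average site pair (`rfl`).
[cite: Balaban1985BackgroundPropagators, (3.26) p.395, bookkeeping] -/
theorem deltaAY_eq_deltaAQQY (parS : SiteParY 𝔸 i) (parB : BondParY 𝔸 i) (U : CfgY 𝔸 i) :
    deltaAY i parS parB Gp U = deltaAQQY i (QY i parB) (QsY i parB) (QpY i parS) (QpsY i parS) Gp U := rfl

/-- def-Y's `OpsYDeltaA.GAY` IS `GAQQY` at `(QY parB, QsY parB)` × the block-average site pair (`rfl`). [cite: Balaban1985BackgroundPropagators, (3.27) p.395, bookkeeping] -/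
theorem GAY_eq_GAQQY (parS : SiteParY 𝔸 i) (parB : BondParY 𝔸 i) : GAY i parS parB Gp = GAQQY i (QY i parB) (QsY i parB) (QpY i parS) (QpsY i parS) Gp := rfl

/-- `Δ_a[𝔮; 𝔭, c·G′] = Δ_a[𝔮; 𝔭, G′]` for `c ≠ 0` (the form sees `G′` only through `R`). [cite: Balaban1985BackgroundPropagators, (3.26) p.395] -/
theorem deltaAQQY_smul_Gp {c : ℂ} (hc : c ≠ 0) (U : CfgY 𝔸 i) : deltaAQQY i 𝔮 𝔮s 𝔭 𝔭s (c • Gp) U = deltaAQQY i 𝔮 𝔮s 𝔭 𝔭s Gp U := by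
  rw [deltaAQQY, deltaAQQY, RQY_smul_Gp i hc]

/-- `G[𝔮; 𝔭, c·G′] = G[𝔮; 𝔭, G′]` for `c ≠ 0`, as letters. [cite: Balaban1985BackgroundPropagators, (3.27) p.395] -/
theorem GAQQY_smul_Gp {c : ℂ} (hc : c ≠ 0) : GAQQY i 𝔮 𝔮s 𝔭 𝔭s (c • Gp) = GAQQY i 𝔮 𝔮s 𝔭 𝔭s Gp :=
  funext fun U => by rw [GAQQY_apply, GAQQY_apply, deltaAQQY_smul_Gp i 𝔮 𝔮s 𝔭 𝔭s Gp hc]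

/-- off the unit locus of `X[𝔭, G′](U)` the restriction drops out: `Δ_a[𝔮; 𝔭, G′](U) = Δ(U) + D_U D*_U + 𝔮⋆a𝔮` (junk row, for the record).
[cite: Balaban1985BackgroundPropagators, (3.26) p.395, bookkeeping] -/
theorem deltaAQQY_of_not_isUnit {U : CfgY 𝔸 i} (hX : ¬ IsUnit (XQY i 𝔭 𝔭s Gp U)) :
    deltaAQQY i 𝔮 𝔮s 𝔭 𝔭s Gp U = hessY i U + gradY i U ∘ₗ divY i U + 𝔮s U ∘ₗ aY i ∘ₗ 𝔮 U := by
  rw [deltaAQQY, RQY_of_not_isUnit i hX, LinearMap.id_comp]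

end SlotA

/-! ## §3 The flat site pair of record in the `OpsY` carriers: `Q′♭`, `Q′♭⋆` indexed by the `k`-lattice, print's `Δ′♭_a`, `G′♭`, and the slot-(a) letters -/

section Flat

variable (i : KIdx d ℓ hd hL b₀ b₁)

/-- the `k`-LATTICE sites `T^{(k)}` of the torus of the index (the centres of the `k`-blocks of the whole torus; the target carrier of the background scheme's
`QflatOfRecord F N k`). [cite: Balaban1987RG1, (0.1) p.251; Balaban1985Averaging, (11) p.19, dictionary] -/
abbrev KSiteY (i : KIdx d ℓ hd hL b₀ b₁) : Type := Site (PV d ℓ i.m i.K hd hL) i.k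

/-- the `k`-centre `y`, embedded in the finest lattice (`embIter i.k`) and read in NODE 00's box chart (`boxEquiv i.hN`). [cite: Balaban1987RG1, (0.1) p.251;
Balaban1984PropagatorsII, (2.1) p.224, dictionary] -/
def kCtrY (y : KSiteY i) : SiteY i := boxEquiv i.hN (embIter i.k y)

/-- `kCtrY`, unfolded. [cite: Balaban1987RG1, (0.1) p.251, bookkeeping] -/
theorem kCtrY_apply (y : KSiteY i) : kCtrY i y = boxEquiv i.hN (embIter i.k y) := rfl

/-- the chart image of the `k`-centres is injective (standing range `i.hk : k ≤ m + K`, `OpsYCoarseBondRep.embIter_injective`). [cite: Balaban1987RG1, (0.1) p.251, bookkeeping] -/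
theorem kCtrY_injective : Function.Injective (kCtrY i) :=
  (boxEquiv i.hN).injective.comp (embIter_injective (P := PV d ℓ i.m i.K hd hL) i.k i.hk)

open Classical in
/-- the kernel of the flat site letter: `q♭(y, z) = [z = kCtrY y]`. [cite: Balaban1985Averaging, (11) p.19; Balaban1985BackgroundPropagators, (3.19) p.393 (the slot)] -/
def qkK : Matrix (KSiteY i) (SiteY i) ℝ := Matrix.of fun y z => if z = kCtrY i y then 1 else 0

/-- ★ **THE FLAT SITE LETTER `Q′♭` IN THE `OpsY` CARRIERS**: restriction of a site function to the (charted) `k`-centres, `(Q′♭λ)(y) = λ(kCtrY i y)` —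
CONFIGURATION-FREE, `Ω`-free, NO datum: the background scheme's `QflatOfRecord_apply` (`(Q′♭λ)(y) = λ(embIter k y)`) read through the chart `boxEquiv i.hN`.
[cite: Balaban1985Averaging, (11) p.19; Balaban1985BackgroundPropagators, (3.19)–(3.21) p.393–394 (the slot)] -/
def QkY : (SiteY i → 𝔸) →ₗ[ℂ] (KSiteY i → 𝔸) := liftMatY 𝔸 (qkK i)

/-- ★ **`Q′♭⋆`**: extension by zero from the `k`-centres, `(Q′♭⋆ω)(kCtrY i y) = ω(y)`, `0` elsewhere — the adjoint of `Q′♭` for the UNWEIGHTED (weight-`1`) site ∕ `k`-site trace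
pairings (`isAdjTr_QkY_QksY`).  The background scheme pairs sites with the UNIFORM weights `c0Rec F K k`, `WRec N` (`SiteL2K`); its adjoint of `Q′♭` is a positive
scalar multiple of this one (absorbed by the datum `a′` below), and the orthogonal complement `N(Q′♭)ᗮ` — hence the projection `R♭` — is the same for both.
[cite: Balaban1985BackgroundPropagators, p.393 («Q′* the adjoint of Q′»), (3.25) p.394] -/
def QksY : (KSiteY i → 𝔸) →ₗ[ℂ] (SiteY i → 𝔸) := liftMatY 𝔸 (qkK i)ᵀ

omit [CompleteSpace 𝔸] in
/-- `(Q′♭λ)(y) = λ(kCtrY i y)`. [cite: Balaban1985Averaging, (11) p.19, bookkeeping] -/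
@[simp] theorem QkY_apply (lam : SiteY i → 𝔸) (y : KSiteY i) : QkY i lam y = lam (kCtrY i y) := by
  classical
  rw [QkY, liftMatY_apply]
  simp only [qkK, Matrix.of_apply]
  rw [Finset.sum_eq_single (kCtrY i y) (fun z _ hz => by rw [if_neg hz, Complex.ofReal_zero, zero_smul]) (fun h => (h (Finset.mem_univ _)).elim),
    if_pos rfl, Complex.ofReal_one, one_smul]

omit [CompleteSpace 𝔸] in
/-- … i.e. `(Q′♭λ)(y) = λ(boxEquiv i.hN (embIter i.k y))` — `QflatOfRecord_apply`'s shape in the `OpsY` carriers. [cite: Balaban1985Averaging, (11) p.19, bookkeeping] -/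
theorem QkY_apply_eq (lam : SiteY i → 𝔸) (y : KSiteY i) : QkY i lam y = lam (boxEquiv i.hN (embIter i.k y)) := QkY_apply i lam y

omit [CompleteSpace 𝔸] in
/-- `Q′♭λ = 0 ↔ λ` vanishes at every charted `k`-centre (`QflatOfRecord_eq_zero_iff`'s shape). [cite: Balaban1985Averaging, (11) p.19; Balaban1985BackgroundPropagators, (3.21) p.394 (N(Q′))] -/
theorem QkY_eq_zero_iff (lam : SiteY i → 𝔸) : QkY i lam = 0 ↔ ∀ y : KSiteY i, lam (kCtrY i y) = 0 := by
  simp only [funext_iff, QkY_apply, Pi.zero_apply]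

open Classical in
omit [CompleteSpace 𝔸] in
/-- `(Q′♭⋆ω)(z) = Σ_y [z = kCtrY i y]·ω(y)`. [cite: Balaban1985BackgroundPropagators, p.393, bookkeeping] -/
theorem QksY_apply (ω : KSiteY i → 𝔸) (z : SiteY i) : QksY i ω z = ∑ y, if z = kCtrY i y then ω y else 0 := by
  rw [QksY, liftMatY_apply]
  refine Finset.sum_congr rfl fun y _ => ?_
  simp only [qkK, Matrix.transpose_apply, Matrix.of_apply]
  split_ifs <;> simp

omit [CompleteSpace 𝔸] in
/-- `Q′♭⋆ω` vanishes off the charted `k`-centres. [cite: Balaban1985BackgroundPropagators, p.393, bookkeeping] -/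
theorem QksY_apply_of_forall_ne (ω : KSiteY i → 𝔸) {z : SiteY i} (hz : ∀ y, kCtrY i y ≠ z) : QksY i ω z = 0 := by
  rw [QksY_apply]
  exact Finset.sum_eq_zero fun y _ => if_neg fun h => hz y h.symm

omit [CompleteSpace 𝔸] in
/-- at a charted `k`-centre, `(Q′♭⋆ω)(kCtrY i y) = ω(y)`. [cite: Balaban1985BackgroundPropagators, p.393, bookkeeping] -/
theorem QksY_apply_kCtrY (ω : KSiteY i → 𝔸) (y : KSiteY i) : QksY i ω (kCtrY i y) = ω y := by
  classical
  rw [QksY_apply, Finset.sum_eq_single y (fun t _ ht => if_neg fun h => ht (kCtrY_injective i h.symm)) (fun h => (h (Finset.mem_univ _)).elim), if_pos rfl]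

omit [CompleteSpace 𝔸] in
/-- ★ **`Q′♭ Q′♭⋆ = 1`** — the flat pair has the trivial `Q′Q′*` letter (contrast the block average); no hypothesis.
[cite: Balaban1985BackgroundPropagators, (3.25) p.394, Thm 3.2 p.398 (the letter `Q′G′²Q′*`), bookkeeping] -/
theorem QkY_comp_QksY : QkY i ∘ₗ QksY (𝔸 := 𝔸) i = LinearMap.id :=
  LinearMap.ext fun ω => funext fun y => by rw [LinearMap.comp_apply, QkY_apply, QksY_apply_kCtrY, LinearMap.id_apply]

omit [CompleteSpace 𝔸] in
/-- `Q′♭⋆ Q′♭ λ` keeps the values at the charted `k`-centres … [cite: Balaban1985BackgroundPropagators, (3.24) p.394 (Q′*aQ′), bookkeeping] -/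
theorem QksY_QkY_apply_kCtrY (lam : SiteY i → 𝔸) (y : KSiteY i) : QksY i (QkY i lam) (kCtrY i y) = lam (kCtrY i y) := by
  rw [QksY_apply_kCtrY, QkY_apply]

omit [CompleteSpace 𝔸] in
/-- … and kills the others: `Q′♭⋆Q′♭` is the projection onto the functions supported on the charted `k`-centres (= `proj_{N(Q′♭)ᗮ}` of the background scheme).
[cite: Balaban1985BackgroundPropagators, (3.24) p.394, bookkeeping] -/
theorem QksY_QkY_apply_of_forall_ne (lam : SiteY i → 𝔸) {z : SiteY i} (hz : ∀ y, kCtrY i y ≠ z) : QksY i (QkY i lam) z = 0 :=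
  QksY_apply_of_forall_ne i _ hz

variable (a' : ℝ)

/-- ★ **print's `Δ′♭_a(U) := Δ_U + Q′♭⋆ a′ Q′♭`** — (3.24) at the flat pair (the background scheme's `Δ_{U₀} + a′·proj_{N(Q′♭)ᗮ}`, up to the weight scalar in `a′`).
[cite: Balaban1985BackgroundPropagators, (3.24) p.394] -/
def deltaPrimeFlatY (U : CfgY 𝔸 i) : (SiteY i → 𝔸) →ₗ[ℂ] (SiteY i → 𝔸) :=
  lapSL i U + QksY i ∘ₗ ((((a' : ℝ) : ℂ)) • LinearMap.id) ∘ₗ QkY i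

/-- ★ **`G′♭(U) := (Δ′♭_a(U))⁻¹`** (`Ring.inverse`, total; lattice units). [cite: Balaban1985BackgroundPropagators, (3.24)–(3.25) p.394 («Its inverse is denoted by G′»)] -/
def GpFlatY : SiteOpY 𝔸 i := fun U => Ring.inverse (deltaPrimeFlatY i a' U)

/-- `G′♭`, evaluated. [cite: Balaban1985BackgroundPropagators, (3.25) p.394, bookkeeping] -/
theorem GpFlatY_apply (U : CfgY 𝔸 i) : GpFlatY i a' U = Ring.inverse (deltaPrimeFlatY i a' U) := rfl

/-- `X♭(U) = Q′♭G′♭²Q′♭⋆` at the flat pair. [cite: Balaban1985BackgroundPropagators, (3.25) p.394] -/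
abbrev XFlatY (U : CfgY 𝔸 i) : (KSiteY i → 𝔸) →ₗ[ℂ] (KSiteY i → 𝔸) := XQY i (fun _ => QkY i) (fun _ => QksY i) (GpFlatY i a') U

/-- ★ **`R♭(U) = I − G′♭Q′♭⋆(Q′♭G′♭²Q′♭⋆)⁻¹Q′♭G′♭`** — (3.25) at the flat pair: the `OpsY` twin of the background scheme's `RrOfRecord … Q′♭` (orthogonal projection onto
`Δ_U N(Q′♭)`). [cite: Balaban1985BackgroundPropagators, (3.21) p.394, (3.25) p.394] -/
abbrev RFlatY (U : CfgY 𝔸 i) : (SiteY i → 𝔸) →ₗ[ℂ] (SiteY i → 𝔸) := RQY i (fun _ => QkY i) (fun _ => QksY i) (GpFlatY i a') U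

variable (𝔮 : CfgY 𝔸 i → ((FBondY i → 𝔸) →ₗ[ℂ] (IBondY i → 𝔸))) (𝔮s : CfgY 𝔸 i → ((IBondY i → 𝔸) →ₗ[ℂ] (FBondY i → 𝔸)))

/-- ★★ **`Δ_a♭[𝔮](U) = Δ(U) + D_U R♭(U) D*_U + 𝔮⋆(U) a 𝔮(U)`** — the slot-(a) form at a generic bond pair and the FLAT site pair: the `OpsY` twin of the background scheme's
`laplaceAOfRecord … Q Q′♭ a`. [cite: Balaban1985BackgroundPropagators, (3.26) p.395; Balaban1985Variational, (110) p.294] -/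
abbrev deltaAFlatY (U : CfgY 𝔸 i) : (FBondY i → 𝔸) →ₗ[ℂ] (FBondY i → 𝔸) := deltaAQQY i 𝔮 𝔮s (fun _ => QkY i) (fun _ => QksY i) (GpFlatY i a') U

/-- ★★ **`G♭[𝔮] = (Δ_a♭[𝔮])⁻¹`** — the slot-(a) inverse at the flat pair (`G₀` of (3.130) for the flat scheme). [cite: Balaban1985BackgroundPropagators, (3.27) p.395, (3.130) p.421] -/
abbrev GAFlatY : BondOpY 𝔸 i := GAQQY i 𝔮 𝔮s (fun _ => QkY i) (fun _ => QksY i) (GpFlatY i a')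

/-- ★★ **`(𝔮 G♭[𝔮] 𝔮⋆)⁻¹`** — the (3.132)-slot letter of the flat scheme at slot (a) (`OpsYSectDQ.QGQinvOfQY` at `G := G♭[𝔮]`). [cite: Balaban1985BackgroundPropagators, (3.132) p.422] -/
abbrev QGAQinvFlatY (U : CfgY 𝔸 i) : (IBondY i → 𝔸) →ₗ[ℂ] (IBondY i → 𝔸) := QGQinvOfQY i 𝔮 𝔮s (GAFlatY i a' 𝔮 𝔮s) U

/-- ★★★ **`H♭[𝔮] = G♭[𝔮] 𝔮⋆ (𝔮 G♭[𝔮] 𝔮⋆)⁻¹`** — the slot-(a) gauge letter at a generic bond pair and the flat site pair (`OpsYSectDQ.HOfQY` at `G := G♭[𝔮]`): the `OpsY`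
object whose (3.133) reading is to be read back onto `BgGaugeLetterOfRecord.H1OfRecordAtBgFlat` (the readback identity is NOT asserted here).
[cite: Balaban1985BackgroundPropagators, (3.126) p.420, (3.133) p.422; Balaban1985Variational, (103) p.293] -/
abbrev HAFlatY (U : CfgY 𝔸 i) : (IBondY i → 𝔸) →ₗ[ℂ] (FBondY i → 𝔸) := HOfQY i 𝔮 𝔮s (GAFlatY i a' 𝔮 𝔮s) U

/-- `H♭[𝔮]`, unfolded to (3.126)'s shape. [cite: Balaban1985BackgroundPropagators, (3.126) p.420, bookkeeping] -/
theorem HAFlatY_eq (U : CfgY 𝔸 i) : HAFlatY i a' 𝔮 𝔮s U = GAFlatY i a' 𝔮 𝔮s U ∘ₗ 𝔮s U ∘ₗ QGAQinvFlatY i a' 𝔮 𝔮s U := rfl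

/-- `Δ_a♭[𝔮]`, unfolded. [cite: Balaban1985BackgroundPropagators, (3.26) p.395, bookkeeping] -/
theorem deltaAFlatY_eq (U : CfgY 𝔸 i) :
    deltaAFlatY i a' 𝔮 𝔮s U = hessY i U + gradY i U ∘ₗ RFlatY i a' U ∘ₗ divY i U + 𝔮s U ∘ₗ aY i ∘ₗ 𝔮 U := rfl

/-- `X♭(U)`, unfolded (its unit locus is the regime of the §1 laws for the flat letters). [cite: Balaban1985BackgroundPropagators, (3.25) p.394, Thm 3.2 p.398, bookkeeping] -/
theorem XFlatY_eq (U : CfgY 𝔸 i) : XFlatY i a' U = QkY i ∘ₗ GpFlatY i a' U ∘ₗ GpFlatY i a' U ∘ₗ QksY i := rfl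

end Flat

/-! ### §3b Trace-adjointness and symmetry of the flat letters at `𝔸 = M_N(ℂ)` -/

section FlatSymm

open scoped Matrix.Norms.L2Operator

variable {N : ℕ} (i : KIdx d ℓ hd hL b₀ b₁) (a' : ℝ)

/-- ★ **`Q′♭⋆` IS THE WEIGHT-`1` TRACE ADJOINT OF `Q′♭`** (no transport, so no unitarity hypothesis). [cite: Balaban1985BackgroundPropagators, p.393 («Q′* the adjoint of Q′»)] -/
theorem isAdjTr_QkY_QksY : IsAdjTr (fun _ => (1 : ℝ)) (fun _ => (1 : ℝ)) (QkY (𝔸 := Matrix (Fin N) (Fin N) ℂ) i) (QksY i) := by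
  have h := isAdjTr_trLiftY_transpose (qkK i) (fun (_ : KSiteY i) (_ : SiteY i) => (1 : (Matrix (Fin N) (Fin N) ℂ)ˣ)) fun _ _ _ => by
    rw [Units.val_one]; exact Submonoid.one_mem _
  have h1 : trLiftY (qkK i) (fun (_ : KSiteY i) (_ : SiteY i) => (1 : (Matrix (Fin N) (Fin N) ℂ)ˣ)) = QkY i :=
    trLiftY_eq_liftMatY_of_one _ fun _ _ => rfl
  have h2 : trLiftY (qkK i)ᵀ (fun (_ : SiteY i) (_ : KSiteY i) => (1 : (Matrix (Fin N) (Fin N) ℂ)ˣ)⁻¹) = QksY i :=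
    trLiftY_eq_liftMatY_of_one _ fun _ _ => inv_one
  simpa only [h1, h2] using h

/-- `Δ′♭_a(U)` is trace-symmetric at a unitary-valued configuration. [cite: Balaban1985BackgroundPropagators, (3.24) p.394, Thm 3.11 p.416 («symmetric»)] -/
theorem deltaPrimeFlatY_isSymmTr (U : CfgY (Matrix (Fin N) (Fin N) ℂ) i)
    (hU : ∀ μ x, ((U μ x : (Matrix (Fin N) (Fin N) ℂ)ˣ) : Matrix (Fin N) (Fin N) ℂ) ∈ unitary (Matrix (Fin N) (Fin N) ℂ)) :
    IsSymmTr (fun _ => (1 : ℝ)) (deltaPrimeFlatY i a' U) := by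
  unfold deltaPrimeFlatY
  exact isSymmTr_add _ (lapSL_isSymmTr i U hU) (isSymmTr_sandwich_of_isAdjTr (isAdjTr_QkY_QksY i) (isSymmTr_coe_real_smul _ a' (isSymmTr_id _)))

/-- ★ `G′♭(U)` is trace-symmetric at a unitary-valued configuration. [cite: Balaban1985BackgroundPropagators, (3.25) p.394, Thm 3.11 p.416 («symmetric»)] -/
theorem GpFlatY_isSymmTr (U : CfgY (Matrix (Fin N) (Fin N) ℂ) i)
    (hU : ∀ μ x, ((U μ x : (Matrix (Fin N) (Fin N) ℂ)ˣ) : Matrix (Fin N) (Fin N) ℂ) ∈ unitary (Matrix (Fin N) (Fin N) ℂ)) :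
    IsSymmTr (fun _ => (1 : ℝ)) (GpFlatY i a' U) :=
  isSymmTr_ringInverse _ (deltaPrimeFlatY_isSymmTr i a' U hU)

/-- ★★ **`R♭(U)` is trace-symmetric** at a unitary-valued configuration (print: «an orthogonal projection»). [cite: Balaban1985BackgroundPropagators, (3.21) p.394, (3.25) p.394] -/
theorem RFlatY_isSymmTr (U : CfgY (Matrix (Fin N) (Fin N) ℂ) i)
    (hU : ∀ μ x, ((U μ x : (Matrix (Fin N) (Fin N) ℂ)ˣ) : Matrix (Fin N) (Fin N) ℂ) ∈ unitary (Matrix (Fin N) (Fin N) ℂ)) :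
    IsSymmTr (fun _ => (1 : ℝ)) (RFlatY i a' U) :=
  RQY_isSymmTr i (fun _ => (1 : ℝ)) U (GpFlatY_isSymmTr i a' U hU) (isAdjTr_QkY_QksY i)

end FlatSymm

end

end Literature.MathematicalPhysics.QuantumFieldTheory.Balaban1983to89.Node00.OpsYDeltaAFlat
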